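import Literature.Analysis.FluidPDE.ExtremeGrowthBoundsProofs
import Literature.Analysis.FluidPDE.ExtremeGrowthVorticityControl
import Literature.Analysis.FunctionSpaces.TorusClassicalNSGluing
import Mathlib.Topology.Order.Compact
import HarnessLib

/-!
# Extreme growth — long windows are tame (Leray's eventual regularity, quantitative on `T³`)

Analysis/FluidPDE theorem file, sibling of `ExtremeGrowthBounds.lean` (the FIXED-ENERGY yardstick of
the fluid-computer optimiser analysis, BOUNDS.md (1.10)(b)). Along a zero-mean classical solution of
the unforced Navier–Stokes equations on the unit 3-torus over a time window `[a, b]` of length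
`T = b − a`, with initial kinetic energy `K₀ = K(u(a)) = ½‖u(a)‖₂²` and enstrophy
`ℰ = ½‖∇u‖₂²` (`torusEnstrophy`):

1. **Mean-value step** (the energy budget `2ν ∫ₐᵇ ℰ ≤ K₀`, tree
   `two_mul_integral_torusEnstrophy_le_kineticEnergy`, and continuity of `t ↦ ℰ(u(t))`): some
   `t ∈ [a, b]` has `ℰ(u(t)) ≤ K₀/(2νT)` (`exists_torusEnstrophy_le_kineticEnergy_div`). This is the
   choice of a good time in Leray's eventual-regularity argument (Leray 1934;
   Robinson–Rodrigo–Sadowski 2016, proof of Thm. 8.1). No dimension or mean hypothesis is needed.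
2. **Long windows** (`d = 3`): if `T ≥ τ₁(ν, K₀) := 27 K₀²/(16 π⁴ ν⁵)` (`luDoeringTameTime`), then at
   the good time `σ = 27 K(u(t)) ℰ(u(t))/(2πν)⁴ ≤ 27 K₀ · K₀/(2νT)/(2πν)⁴ ≤ ½`, so the Lu–Doering
   small-data bound (Ayala–Protas 2017, eqs. (2.10)–(2.12); tree `torusEnstrophy_le_of_small`, now
   unconditional through `LuDoering2008_enstrophyRate_le_holds`) started at `t` gives
   `ℰ(u(b)) ≤ ℰ(u(t))/(1 − σ) ≤ 2ℰ(u(t)) ≤ K₀/(νT)`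
   (`torusEnstrophy_le_kineticEnergy_div_of_tameTime_le`); equivalently the fixed-energy burst ratio
   `b := 2νT ℰ(u(b))/K₀` is at most `2` (`two_mul_nu_mul_window_mul_torusEnstrophy_le`), to be
   compared with the exact Stokes value `1/e` (`ExtremeGrowthYardsticks`).
3. **Eventual bounds**: for every later time `s` with `s − a ≥ τ₁`,
   `ℰ(u(s)) ≤ K₀/(ν(s − a)) ≤ 16π⁴ν⁴/(27 K₀)` and `K(u(s)) ℰ(u(s)) ≤ (2πν)⁴/27 =
   luDoeringSmallDataThreshold ν` — from the Leray time `τ₁` on, the state sits at or below the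
   Lu–Doering small-data threshold (`kineticEnergy_mul_torusEnstrophy_le_threshold_of_tameTime_le`).

For SHORT windows `T < τ₁` no a-priori bound on `ℰ(u(b))` in terms of `K₀` alone is known (that is
the regularity problem); nothing here claims one. Positivity of the enstrophy along the window is
carried as a hypothesis exactly as in `torusEnstrophy_le_of_small`.

## Mathlib / tree search

Tree: `two_mul_integral_torusEnstrophy_le_kineticEnergy`, `kineticEnergy_le_of_le`
(`ExtremeGrowthVorticityControl`), `torusEnstrophy_le_of_small`, `luDoeringConst_div_two_nu`
(`ExtremeGrowthBounds`), `LuDoering2008_enstrophyRate_le_holds` (`ExtremeGrowthBoundsProofs`),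
`Torus.IsClassicalNSSolutionOn.mono` (`TorusClassicalNSGluing`),
`Torus.IsClassicalNSSolutionOn.hasDerivWithinAt_half_gradNormSq` (`TorusClassicalH1Balance`).
Mathlib: `IsCompact.exists_isMinOn`, `intervalIntegral.integral_mono_on`,
`ContinuousOn.intervalIntegrable_of_Icc`, `uniqueDiffOn_Icc`.

## References

* J. Leray, *Sur le mouvement d'un liquide visqueux emplissant l'espace*, Acta Math. 63 (1934)
  193–248 (eventual regularity). [Leray1934]
* J. C. Robinson, J. L. Rodrigo, W. Sadowski, *The three-dimensional Navier–Stokes equations*,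
  CUP 2016, Thm. 6.13 (small `‖u₀‖‖∇u₀‖` ⇒ global strong) and Thm. 8.1 with its proof (choice of
  a time with small `‖∇u‖` from `∫‖∇u‖² ≤ ½‖u₀‖²`). [RobinsonRodrigoSadowski2016]
* D. Ayala, B. Protas, *Extreme vortex states and the growth of enstrophy in three-dimensional
  incompressible flows*, J. Fluid Mech. 818 (2017) 772–806, eqs. (2.10)–(2.12). [AyalaProtas2017]
* C. R. Doering, C. Foias, *Energy dissipation in body-forced turbulence*, J. Fluid Mech. 467
  (2002) 289–306, (2.4) (energy identity). [DoeringFoias2002]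
-/

noncomputable section

open Set MeasureTheory intervalIntegral
open scoped InnerProductSpace

namespace Literature.Analysis.FluidPDE

open Literature.Analysis.FunctionSpaces

/-! ## The Leray (tame-window) time -/

section Constants

/-- The TAME-WINDOW (Leray) time `τ₁(ν, K₀) = 27 K₀²/(16 π⁴ ν⁵)`: the window length beyond which
the energy budget `2ν∫ℰ ≤ K₀` and the Lu–Doering small-data threshold `(2πν)⁴/27`
(Ayala–Protas 2017, eq. (2.12)) force the terminal enstrophy below `K₀/(νT)`; `τ₁ = (C_LD/(2ν)) K₀²/ν`
(`luDoeringTameTime_eq`). The quantitative form, on `T³` with the explicit Lu–Doering constant, of the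
time chosen in the proof of Leray's eventual regularity (Robinson–Rodrigo–Sadowski 2016, Thm. 8.1).
[cite: RobinsonRodrigoSadowski2016, Thm. 8.1 (proof)] -/
def luDoeringTameTime (ν K₀ : ℝ) : ℝ :=
  27 * K₀ ^ 2 / (16 * Real.pi ^ 4 * ν ^ 5)

/-- `τ₁ ≥ 0` for `ν ≥ 0`. [cite: RobinsonRodrigoSadowski2016, Thm. 8.1 (proof)] -/
theorem luDoeringTameTime_nonneg {ν : ℝ} (hν : 0 ≤ ν) (K₀ : ℝ) : 0 ≤ luDoeringTameTime ν K₀ := by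
  unfold luDoeringTameTime
  positivity

/-- `τ₁(ν, K₀) = (C_LD(ν)/(2ν)) · K₀²/ν` with `C_LD/(2ν) = 27/(2πν)⁴` (Ayala–Protas 2017, eq. (2.10)).
[cite: AyalaProtas2017, eq. (2.10)] -/
theorem luDoeringTameTime_eq {ν : ℝ} (hν : ν ≠ 0) (K₀ : ℝ) :
    luDoeringTameTime ν K₀ = luDoeringConst ν / (2 * ν) * K₀ ^ 2 / ν := by
  unfold luDoeringTameTime luDoeringConst
  have hπ : Real.pi ≠ 0 := Real.pi_ne_zero
  field_simp
  ring

/-- `K₀²/(ν τ₁) = (2πν)⁴/27 = luDoeringSmallDataThreshold ν` for `K₀ ≠ 0`: over a window of length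
exactly `τ₁` the bound `K₀ · K₀/(νT)` on `K ℰ` is the small-data threshold (Ayala–Protas 2017,
eq. (2.12)). [cite: AyalaProtas2017, eq. (2.12)] -/
theorem sq_div_nu_mul_luDoeringTameTime {ν K₀ : ℝ} (hν : ν ≠ 0) (hK : K₀ ≠ 0) :
    K₀ ^ 2 / (ν * luDoeringTameTime ν K₀) = luDoeringSmallDataThreshold ν := by
  unfold luDoeringTameTime luDoeringSmallDataThreshold
  have hπ : Real.pi ≠ 0 := Real.pi_ne_zero
  field_simp
  ring

end Constants

/-! ## The mean-value step and the long-window bounds -/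

section Torus

variable {d : Type*} [Fintype d] [DecidableEq d]

/-- **A good time exists (mean-value step of Leray's eventual regularity).** Along a classical
solution of the unforced Navier–Stokes equations (`ν > 0`) on the unit torus over `[a, b]`, `a < b`,
some `t ∈ [a, b]` has `ℰ(u(t)) ≤ K(u(a))/(2ν(b − a))`: the enstrophy is continuous in time
(`Torus.IsClassicalNSSolutionOn.hasDerivWithinAt_half_gradNormSq`), attains its minimum `m` on the
compact window, and `2ν(b − a) m ≤ 2ν∫ₐᵇ ℰ ≤ K(u(a))` (`two_mul_integral_torusEnstrophy_le_kineticEnergy`).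
Any dimension, no mean condition (Robinson–Rodrigo–Sadowski 2016, proof of Thm. 8.1: "the set of
`s` with `‖∇u(s)‖ ≤ C/‖u₀‖` has infinite measure"). [cite: RobinsonRodrigoSadowski2016, Thm. 8.1 (proof)] -/
theorem exists_torusEnstrophy_le_kineticEnergy_div {ν a b : ℝ} (hν : 0 < ν) (hab : a < b)
    {u : ℝ → UnitAddTorus d → EuclideanSpace ℝ d} {p : ℝ → UnitAddTorus d → ℝ}
    (h : Torus.IsClassicalNSSolutionOn (Icc a b) ν 0 u p) :
    ∃ t ∈ Icc a b, torusEnstrophy (u t) ≤ Torus.kineticEnergy (u a) / (2 * ν * (b - a)) := by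
  have hcont : ContinuousOn (fun s => torusEnstrophy (u s)) (Icc a b) := by
    intro s hs
    have hds : HasDerivWithinAt (fun r => torusEnstrophy (u r)) _ (Icc a b) s :=
      h.hasDerivWithinAt_half_gradNormSq hab hs
    exact hds.continuousWithinAt
  obtain ⟨t, ht, hmin⟩ := isCompact_Icc.exists_isMinOn (nonempty_Icc.2 hab.le) hcont
  refine ⟨t, ht, ?_⟩
  have hbudget := two_mul_integral_torusEnstrophy_le_kineticEnergy h (convex_Icc a b) hab.le
    Subset.rfl
  have hint : IntervalIntegrable (fun s => torusEnstrophy (u s)) volume a b :=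
    hcont.intervalIntegrable_of_Icc hab.le
  have hlow : (b - a) * torusEnstrophy (u t) ≤ ∫ s in a..b, torusEnstrophy (u s) := by
    have h1 := intervalIntegral.integral_mono_on hab.le
      (intervalIntegrable_const (μ := volume) (c := torusEnstrophy (u t))) hint
      (fun s hs => (isMinOn_iff.mp hmin) s hs)
    simpa [intervalIntegral.integral_const, smul_eq_mul] using h1
  have hT : 0 < 2 * ν * (b - a) := by
    have : 0 < b - a := sub_pos.2 hab
    positivity
  rw [le_div_iff₀ hT]
  have h2 := mul_le_mul_of_nonneg_left hlow (le_of_lt (mul_pos two_pos hν))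
  nlinarith [h2, hbudget]

/-- **Long windows are tame (conditional form, any proof of the Lu–Doering estimate).** Under
`LuDoering2008_enstrophyRate_le`, along a zero-mean classical solution of unforced Navier–Stokes on
`T³ × [a, b]` with positive enstrophy: if the window is longer than the Leray time,
`τ₁(ν, K(u(a))) = 27 K(u(a))²/(16π⁴ν⁵) ≤ b − a`, then `ℰ(u(b)) ≤ K(u(a))/(ν(b − a))`. Proof: at the
good time `t` of `exists_torusEnstrophy_le_kineticEnergy_div`, `σ = (C_LD/(2ν)) K(u(t)) ℰ(u(t)) ≤
27 K(u(a))²/(32π⁴ν⁵(b − a)) ≤ ½` (energy decay `kineticEnergy_le_of_le`), and the small-data bound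
(Ayala–Protas 2017, eqs. (2.11)–(2.12), `torusEnstrophy_le_of_small`) restarted at `t`
(`Torus.IsClassicalNSSolutionOn.mono`) gives `ℰ(u(b)) ≤ ℰ(u(t))/(1 − σ) ≤ 2ℰ(u(t))`.
[cite: AyalaProtas2017, eqs. (2.11)–(2.12)] -/
theorem torusEnstrophy_le_kineticEnergy_div_of_tameTime_le_of_LD
    (hLD : LuDoering2008_enstrophyRate_le (d := d)) (hd : Fintype.card d = 3) {ν a b : ℝ}
    (hν : 0 < ν) (hab : a < b)
    {u : ℝ → UnitAddTorus d → EuclideanSpace ℝ d} {p : ℝ → UnitAddTorus d → ℝ}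
    (h : Torus.IsClassicalNSSolutionOn (Icc a b) ν 0 u p)
    (hmean : ∀ t ∈ Icc a b, Torus.HasZeroMean (u t))
    (hpos : ∀ t ∈ Icc a b, 0 < torusEnstrophy (u t))
    (hT : luDoeringTameTime ν (Torus.kineticEnergy (u a)) ≤ b - a) :
    torusEnstrophy (u b) ≤ Torus.kineticEnergy (u a) / (ν * (b - a)) := by
  obtain ⟨t, ht, hEt⟩ := exists_torusEnstrophy_le_kineticEnergy_div hν hab h
  set K₀ : ℝ := Torus.kineticEnergy (u a) with hK₀
  set T : ℝ := b - a with hTdef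
  have hT0 : 0 < T := sub_pos.2 hab
  have hK0 : 0 ≤ K₀ := Torus.kineticEnergy_nonneg _
  have hEt0 : 0 ≤ torusEnstrophy (u t) := torusEnstrophy_nonneg _
  -- the final comparison `2 · K₀/(2νT) = K₀/(νT)`
  have hfin : 2 * (K₀ / (2 * ν * T)) = K₀ / (ν * T) := by
    field_simp
  rcases eq_or_lt_of_le ht.2 with htb | htb
  · -- the good time is `b` itself
    rw [htb] at hEt
    calc torusEnstrophy (u b) ≤ K₀ / (2 * ν * T) := hEt
      _ ≤ 2 * (K₀ / (2 * ν * T)) := by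
          have : 0 ≤ K₀ / (2 * ν * T) := by positivity
          linarith
      _ = K₀ / (ν * T) := hfin
  · -- restart the small-data bound at the good time `t < b`
    have hsub : Icc t b ⊆ Icc a b := Icc_subset_Icc_left ht.1
    have h' : Torus.IsClassicalNSSolutionOn (Icc t b) ν 0 u p :=
      h.mono hsub (uniqueDiffOn_Icc htb)
    have hmean' : ∀ s ∈ Icc t b, Torus.HasZeroMean (u s) := fun s hs => hmean s (hsub hs)
    have hpos' : ∀ s ∈ Icc t b, 0 < torusEnstrophy (u s) := fun s hs => hpos s (hsub hs)
    have hKt : Torus.kineticEnergy (u t) ≤ K₀ :=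
      kineticEnergy_le_of_le hν.le h (convex_Icc a b) ht.1 (Icc_subset_Icc_right ht.2)
    have hKt0 : 0 ≤ Torus.kineticEnergy (u t) := Torus.kineticEnergy_nonneg _
    set σ : ℝ := luDoeringConst ν / (2 * ν) * Torus.kineticEnergy (u t) * torusEnstrophy (u t)
      with hσdef
    have hc : luDoeringConst ν / (2 * ν) = 27 / (16 * Real.pi ^ 4 * ν ^ 4) := by
      rw [luDoeringConst_div_two_nu hν.ne']
      ring
    have hc0 : 0 ≤ 27 / (16 * Real.pi ^ 4 * ν ^ 4) := by positivity
    have hσle : σ ≤ 27 / (16 * Real.pi ^ 4 * ν ^ 4) * K₀ * (K₀ / (2 * ν * T)) := by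
      rw [hσdef, hc]
      have h1 : 27 / (16 * Real.pi ^ 4 * ν ^ 4) * Torus.kineticEnergy (u t) ≤
          27 / (16 * Real.pi ^ 4 * ν ^ 4) * K₀ := mul_le_mul_of_nonneg_left hKt hc0
      exact mul_le_mul h1 hEt hEt0 (mul_nonneg hc0 hK0)
    have hval : 27 / (16 * Real.pi ^ 4 * ν ^ 4) * K₀ * (K₀ / (2 * ν * T)) =
        luDoeringTameTime ν K₀ / (2 * T) := by
      unfold luDoeringTameTime
      have hπ : Real.pi ≠ 0 := Real.pi_ne_zero
      field_simp
    have hhalf : luDoeringTameTime ν K₀ / (2 * T) ≤ 1 / 2 := by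
      rw [div_le_iff₀ (by positivity)]
      linarith
    have hσ : σ ≤ 1 / 2 := by linarith [hσle, hval.le, hval.ge]
    have hmain := torusEnstrophy_le_of_small hLD hd hν htb h' hmean' hpos'
      (by linarith : σ < 1) (right_mem_Icc.2 htb.le)
    calc torusEnstrophy (u b)
        ≤ torusEnstrophy (u t) / (1 - σ) := hmain
      _ ≤ torusEnstrophy (u t) / (1 / 2) :=
          div_le_div_of_nonneg_left hEt0 (by norm_num) (by linarith)
      _ = 2 * torusEnstrophy (u t) := by ring
      _ ≤ 2 * (K₀ / (2 * ν * T)) := by linarith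
      _ = K₀ / (ν * T) := hfin

/-- **Long windows are tame (BOUNDS (1.10)(b)), unconditional.** Along a zero-mean classical
solution of the unforced Navier–Stokes equations on `T³ × [a, b]` with positive enstrophy, if
`27 K(u(a))²/(16π⁴ν⁵) ≤ b − a` then `ℰ(u(b)) ≤ K(u(a))/(ν(b − a))` — the conditional form fed with the
tree's proof `LuDoering2008_enstrophyRate_le_holds` of the Lu–Doering estimate. Leray's eventual
regularity (Robinson–Rodrigo–Sadowski 2016, Thm. 8.1) with the explicit threshold of Ayala–Protas
2017, eq. (2.12). [cite: AyalaProtas2017, eqs. (2.11)–(2.12)] -/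
theorem torusEnstrophy_le_kineticEnergy_div_of_tameTime_le (hd : Fintype.card d = 3) {ν a b : ℝ}
    (hν : 0 < ν) (hab : a < b)
    {u : ℝ → UnitAddTorus d → EuclideanSpace ℝ d} {p : ℝ → UnitAddTorus d → ℝ}
    (h : Torus.IsClassicalNSSolutionOn (Icc a b) ν 0 u p)
    (hmean : ∀ t ∈ Icc a b, Torus.HasZeroMean (u t))
    (hpos : ∀ t ∈ Icc a b, 0 < torusEnstrophy (u t))
    (hT : luDoeringTameTime ν (Torus.kineticEnergy (u a)) ≤ b - a) :
    torusEnstrophy (u b) ≤ Torus.kineticEnergy (u a) / (ν * (b - a)) :=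
  torusEnstrophy_le_kineticEnergy_div_of_tameTime_le_of_LD LuDoering2008_enstrophyRate_le_holds hd
    hν hab h hmean hpos hT

/-- **The fixed-energy burst ratio is at most `2` on long windows**: with `b := 2νT ℰ(u(b))/K₀`
(BOUNDS (1.10); the Stokes flow gives exactly `1/e`), `2ν(b − a) ℰ(u(b)) ≤ 2 K(u(a))` whenever
`b − a ≥ τ₁(ν, K(u(a)))` — product form of `torusEnstrophy_le_kineticEnergy_div_of_tameTime_le`,
no division. [cite: AyalaProtas2017, eqs. (2.11)–(2.12)] -/
theorem two_mul_nu_mul_window_mul_torusEnstrophy_le (hd : Fintype.card d = 3) {ν a b : ℝ}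
    (hν : 0 < ν) (hab : a < b)
    {u : ℝ → UnitAddTorus d → EuclideanSpace ℝ d} {p : ℝ → UnitAddTorus d → ℝ}
    (h : Torus.IsClassicalNSSolutionOn (Icc a b) ν 0 u p)
    (hmean : ∀ t ∈ Icc a b, Torus.HasZeroMean (u t))
    (hpos : ∀ t ∈ Icc a b, 0 < torusEnstrophy (u t))
    (hT : luDoeringTameTime ν (Torus.kineticEnergy (u a)) ≤ b - a) :
    2 * ν * (b - a) * torusEnstrophy (u b) ≤ 2 * Torus.kineticEnergy (u a) := by
  have h1 := torusEnstrophy_le_kineticEnergy_div_of_tameTime_le hd hν hab h hmean hpos hT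
  have hT0 : 0 < ν * (b - a) := mul_pos hν (sub_pos.2 hab)
  rw [le_div_iff₀ hT0] at h1
  nlinarith [h1]

/-- **Eventual bound along the flow**: on a longer window `[a, c]`, at EVERY time `s ∈ [a, c]` past the
Leray time, `τ₁(ν, K(u(a))) ≤ s − a`, the enstrophy obeys `ℰ(u(s)) ≤ K(u(a))/(ν(s − a))` (the
long-window bound applied to the restricted solution on `[a, s]`). In particular
`sup_{s ≥ a + τ₁} ℰ(u(s)) ≤ K(u(a))/(ν τ₁) = 16π⁴ν⁴/(27 K(u(a)))`: eventual regularity with an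
explicit bound (Robinson–Rodrigo–Sadowski 2016, Thm. 8.1; Ayala–Protas 2017, eq. (2.12)).
[cite: RobinsonRodrigoSadowski2016, Thm. 8.1] -/
theorem torusEnstrophy_le_kineticEnergy_div_of_tameTime_le_sub (hd : Fintype.card d = 3)
    {ν a c : ℝ} (hν : 0 < ν)
    {u : ℝ → UnitAddTorus d → EuclideanSpace ℝ d} {p : ℝ → UnitAddTorus d → ℝ}
    (h : Torus.IsClassicalNSSolutionOn (Icc a c) ν 0 u p)
    (hmean : ∀ t ∈ Icc a c, Torus.HasZeroMean (u t))
    (hpos : ∀ t ∈ Icc a c, 0 < torusEnstrophy (u t)) {s : ℝ} (hs : s ∈ Icc a c)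
    (hT : luDoeringTameTime ν (Torus.kineticEnergy (u a)) ≤ s - a) (has : a < s) :
    torusEnstrophy (u s) ≤ Torus.kineticEnergy (u a) / (ν * (s - a)) := by
  have hsub : Icc a s ⊆ Icc a c := Icc_subset_Icc_right hs.2
  have h' : Torus.IsClassicalNSSolutionOn (Icc a s) ν 0 u p := h.mono hsub (uniqueDiffOn_Icc has)
  exact torusEnstrophy_le_kineticEnergy_div_of_tameTime_le hd hν has h'
    (fun t ht => hmean t (hsub ht)) (fun t ht => hpos t (hsub ht)) hT

/-- **From the Leray time on, the state is at or below the Lu–Doering small-data threshold**: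
along a zero-mean classical solution of unforced Navier–Stokes on `T³ × [a, b]` with positive
enstrophy and `b − a ≥ τ₁(ν, K(u(a)))`,
`K(u(b)) ℰ(u(b)) ≤ K(u(a)) · K(u(a))/(ν(b − a)) ≤ K(u(a))²/(ν τ₁) = (2πν)⁴/27 = luDoeringSmallDataThreshold ν`
(energy decay and `torusEnstrophy_le_kineticEnergy_div_of_tameTime_le`; Ayala–Protas 2017,
eq. (2.12), Robinson–Rodrigo–Sadowski 2016, Thm. 6.13/8.1: small `‖u‖‖∇u‖` is the global-strong
regime). [cite: AyalaProtas2017, eq. (2.12)] -/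
theorem kineticEnergy_mul_torusEnstrophy_le_threshold_of_tameTime_le (hd : Fintype.card d = 3)
    {ν a b : ℝ} (hν : 0 < ν) (hab : a < b)
    {u : ℝ → UnitAddTorus d → EuclideanSpace ℝ d} {p : ℝ → UnitAddTorus d → ℝ}
    (h : Torus.IsClassicalNSSolutionOn (Icc a b) ν 0 u p)
    (hmean : ∀ t ∈ Icc a b, Torus.HasZeroMean (u t))
    (hpos : ∀ t ∈ Icc a b, 0 < torusEnstrophy (u t))
    (hT : luDoeringTameTime ν (Torus.kineticEnergy (u a)) ≤ b - a) :
    Torus.kineticEnergy (u b) * torusEnstrophy (u b) ≤ luDoeringSmallDataThreshold ν := by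
  set K₀ : ℝ := Torus.kineticEnergy (u a) with hK₀
  set T : ℝ := b - a with hTdef
  have hT0 : 0 < T := sub_pos.2 hab
  have hK0 : 0 ≤ K₀ := Torus.kineticEnergy_nonneg _
  have hEb0 : 0 ≤ torusEnstrophy (u b) := torusEnstrophy_nonneg _
  have hKb0 : 0 ≤ Torus.kineticEnergy (u b) := Torus.kineticEnergy_nonneg _
  have hKb : Torus.kineticEnergy (u b) ≤ K₀ :=
    kineticEnergy_le_of_le hν.le h (convex_Icc a b) hab.le Subset.rfl
  have hEb := torusEnstrophy_le_kineticEnergy_div_of_tameTime_le hd hν hab h hmean hpos hT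
  have hthr : 0 ≤ luDoeringSmallDataThreshold ν := by
    unfold luDoeringSmallDataThreshold
    positivity
  -- `K(b) ℰ(b) ≤ K₀ · K₀/(νT)`
  have h1 : Torus.kineticEnergy (u b) * torusEnstrophy (u b) ≤ K₀ * (K₀ / (ν * T)) :=
    mul_le_mul hKb hEb hEb0 hK0
  rcases hK0.eq_or_lt with hK00 | hK0pos
  · -- degenerate `K₀ = 0`
    rw [← hK00, zero_mul] at h1
    exact h1.trans hthr
  · -- `K₀ · K₀/(νT) ≤ K₀²/(ν τ₁) = threshold`
    have hτ0 : 0 < luDoeringTameTime ν K₀ := by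
      unfold luDoeringTameTime
      positivity
    have h2 : K₀ * (K₀ / (ν * T)) ≤ K₀ ^ 2 / (ν * luDoeringTameTime ν K₀) := by
      rw [pow_two, mul_div_assoc]
      refine mul_le_mul_of_nonneg_left ?_ hK0
      exact div_le_div_of_nonneg_left hK0 (by positivity) (by nlinarith)
    rw [sq_div_nu_mul_luDoeringTameTime hν.ne' hK0pos.ne'] at h2
    exact h1.trans h2

end Torus

end Literature.Analysis.FluidPDE

end
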